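import Literature.AlgebraicGeometry.Morphisms.CechModuleRefinement
import HarnessLib

/-!
# Vanishing of `Ȟ¹(𝒰, M)` for a sheaf of modules supported on finitely many closed points

For a scheme `f : X → Spec A`, a sheaf of `𝒪_X`-modules `M : X.Modules` and a FINITE set `S` of CLOSED
points of `X` such that `M` is supported on `S` — its sections over every open disjoint from `S` vanish
(`M|_{X ∖ S} = 0`; Hartshorne II Ex. 1.14, Ex. 1.19–1.20) — the first Čech cohomology of `M` with
respect to ANY family of opens `𝒰 = (U_i)` vanishes: every `1`-cocycle is a coboundary
(`cechMZ1_le_cechMB1_of_finite_support`, `CechMH1.eq_zero_of_finite_support`). This is the degree-one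
case of "a sheaf supported on a zero-dimensional closed subset is acyclic" (a finite direct sum of
skyscraper sheaves at closed points; Hartshorne III Thm. 2.7 with supports, `dim = 0`; Godement II
4.4), proved here directly on cochains and for an arbitrary sheaf of modules (no quasi-coherence):

* `MSections.res_injective_of_inter_subset`, `MSections.res_surjective_of_inter_subset` — **restriction
  `Γ(W', M) → Γ(W, M)` is bijective as soon as `W ⊆ W'` contains `S ∩ W'`** (glue with `0` on
  `W' ∖ S`, which is open since `S` is closed);
* `cechMZ1_le_cechMB1_of_finite_support` — for a cocycle `c`, choose `i(p)` with `p ∈ U_{i(p)}`; the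
  sections `c_{i(p) i}` near the points `p ∈ S ∩ U_i`, glued (they live on pairwise `S`-disjoint
  neighbourhoods `U_i ∩ U_{i(p)} ∩ N_p`, `N_p = X ∖ (S ∖ {p})`) and extended to `U_i`, form a `0`-cochain
  `b` with `db = c` by the cocycle identity `c_{ij} = c_{i(p) j} - c_{i(p) i}` near each `p`.

Used by the crux chain W4.4 (`HomologicalConductor.NoZenoR`, S3 G-layer, Lemma L): the quotients
`I_{Z₀}F/𝔞F`, `F(-Z∧Z')/(F(-Z)+F(-Z'))` on a resolution of a surface singularity are supported on
finitely many closed points of the exceptional fibre. Everything is proved; no named facts; no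
definitions. Mathlib searched (pin v4.32): `TopCat.Sheaf.eq_of_locally_eq'`,
`TopCat.Sheaf.existsUnique_gluing'` (through the tree's `MSections.eq_of_res_eq` / `exists_res_eq`),
`Set.Finite.isClosed_biUnion`, `IsOpen.sdiff` (used); Mathlib has skyscraper (pre)sheaves
(`skyscraperPresheaf`) but no Čech vanishing for finitely supported sheaves.

## References

* R. Hartshorne, *Algebraic Geometry*, GTM 52 (1977): II Ex. 1.14, 1.19–1.20 (support, extension by
  zero), III Thm. 2.7 and Ex. 4.x (Čech cohomology). [Hartshorne1977]
* R. Godement, *Topologie algébrique et théorie des faisceaux* (1958), II 4.4, II 5.x.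
-/

noncomputable section

open CategoryTheory AlgebraicGeometry TopologicalSpace Opposite

universe u v

namespace Literature.AlgebraicGeometry.Morphisms

variable {A : Type u} [CommRing A] {X : Scheme.{u}} (f : X ⟶ Spec (.of A)) (M : X.Modules)

/-! ## Restriction is bijective between opens containing the same points of the support -/

namespace MSections

variable {S : Set X}

/-- A finite set of closed points is closed. [folklore] -/
private theorem isClosed_of_finite_of_forall_isClosed_singleton (hS : S.Finite)
    (hT1 : ∀ p ∈ S, IsClosed ({p} : Set X)) : IsClosed S := by
  have h := hS.isClosed_biUnion hT1
  rwa [Set.biUnion_of_singleton] at h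

/-- Two-piece locality: sections over `V` agreeing on opens `W₁, W₂ ⊆ V` covering `V` are equal
(sheaf axiom (3)). [cite: Hartshorne1977, II §1, Definition of a sheaf, conditions (3)–(4) (p. 61)] -/
theorem eq_of_res_eq₂ {V W₁ W₂ : X.Opens} (h₁ : W₁ ≤ V) (h₂ : W₂ ≤ V) (hcov : V ≤ W₁ ⊔ W₂)
    {s t : MSections f M V} (e₁ : res f M h₁ s = res f M h₁ t)
    (e₂ : res f M h₂ s = res f M h₂ t) : s = t := by
  refine eq_of_res_eq f M (fun b : Bool => cond b W₁ W₂) (fun b => Bool.rec h₂ h₁ b) ?_ ?_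
  · refine hcov.trans (sup_le ?_ ?_)
    · exact le_iSup_of_le true le_rfl
    · exact le_iSup_of_le false le_rfl
  · intro b
    cases b
    · exact e₂
    · exact e₁

/-- Two-piece gluing: compatible sections over opens `W₁, W₂ ⊆ V` covering `V` glue (sheaf axiom
(4)). [cite: Hartshorne1977, II §1, Definition of a sheaf, conditions (3)–(4) (p. 61)] -/
theorem exists_res_eq₂ {V W₁ W₂ : X.Opens} (h₁ : W₁ ≤ V) (h₂ : W₂ ≤ V) (hcov : V ≤ W₁ ⊔ W₂)
    (s₁ : MSections f M W₁) (s₂ : MSections f M W₂)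
    (hs : res f M (inf_le_left : W₁ ⊓ W₂ ≤ W₁) s₁ = res f M inf_le_right s₂) :
    ∃ t : MSections f M V, res f M h₁ t = s₁ ∧ res f M h₂ t = s₂ := by
  obtain ⟨t, ht⟩ := exists_res_eq f M (fun b : Bool => cond b W₁ W₂) (fun b => Bool.rec h₂ h₁ b)
    (by
      refine hcov.trans (sup_le ?_ ?_)
      · exact le_iSup_of_le true le_rfl
      · exact le_iSup_of_le false le_rfl)
    (fun b => Bool.rec s₂ s₁ b)
    (by
      intro b b'
      cases b <;> cases b'
      · rfl
      · change res f M (inf_le_left : W₂ ⊓ W₁ ≤ W₂) s₂ = res f M (inf_le_right : W₂ ⊓ W₁ ≤ W₁) s₁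
        have e : W₂ ⊓ W₁ = W₁ ⊓ W₂ := inf_comm _ _
        have h' := congrArg (res f M (le_of_eq e)) hs
        rw [res_res, res_res] at h'
        exact h'.symm
      · exact hs
      · rfl)
  exact ⟨t, ht true, ht false⟩

variable (hsupp : ∀ W : X.Opens, Disjoint (W : Set X) S → ∀ s : MSections f M W, s = 0)
include hsupp

/-- **Restriction `Γ(W', M) → Γ(W, M)` is injective** for `M` supported on the closed set `S` and
`W ⊆ W'` containing `S ∩ W'`. [cite: Hartshorne1977, II Ex. 1.14 and Ex. 1.20] -/
theorem res_injective_of_inter_subset (hSc : IsClosed S) {W W' : X.Opens} (h : W ≤ W')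
    (hW : S ∩ (W' : Set X) ⊆ W) : Function.Injective (res f M h) := by
  intro s t hst
  -- the open `W' ∖ S`, disjoint from `S`, covering `W'` together with `W`
  let V : X.Opens := ⟨(W' : Set X) \ S, W'.2.sdiff hSc⟩
  have hVW' : V ≤ W' := fun _ hx => hx.1
  have hVS : Disjoint (V : Set X) S := Set.disjoint_left.mpr fun _ hx => hx.2
  have hcov : W' ≤ W ⊔ V := fun x hx => by
    by_cases hxS : x ∈ S
    · exact Opens.mem_sup.mpr (Or.inl (hW ⟨hxS, hx⟩))
    · exact Opens.mem_sup.mpr (Or.inr ⟨hx, hxS⟩)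
  refine eq_of_res_eq₂ f M h hVW' hcov hst ?_
  rw [hsupp _ hVS (res f M _ s), hsupp _ hVS (res f M _ t)]

/-- **Restriction `Γ(W', M) → Γ(W, M)` is surjective** for `M` supported on the closed set `S` and
`W ⊆ W'` containing `S ∩ W'` (extend by zero off `S`). [cite: Hartshorne1977, II Ex. 1.19–1.20] -/
theorem res_surjective_of_inter_subset (hSc : IsClosed S) {W W' : X.Opens} (h : W ≤ W')
    (hW : S ∩ (W' : Set X) ⊆ W) : Function.Surjective (res f M h) := by
  intro s
  let V : X.Opens := ⟨(W' : Set X) \ S, W'.2.sdiff hSc⟩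
  have hVW' : V ≤ W' := fun _ hx => hx.1
  have hVS : Disjoint (V : Set X) S := Set.disjoint_left.mpr fun _ hx => hx.2
  have hcov : W' ≤ W ⊔ V := fun x hx => by
    by_cases hxS : x ∈ S
    · exact Opens.mem_sup.mpr (Or.inl (hW ⟨hxS, hx⟩))
    · exact Opens.mem_sup.mpr (Or.inr ⟨hx, hxS⟩)
  obtain ⟨t, ht, -⟩ := exists_res_eq₂ f M h hVW' hcov s (0 : MSections f M V) (by
    rw [map_zero]
    exact hsupp _ (Set.disjoint_of_subset_left
      (show ((W ⊓ V : X.Opens) : Set X) ⊆ (V : Set X) from fun x hx => hx.2) hVS) _)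
  exact ⟨t, ht⟩

end MSections

/-! ## Every Čech `1`-cocycle of a finitely supported sheaf is a coboundary -/

section FiniteSupport

variable {ι : Type v} (U : ι → X.Opens) {S : Set X}

/-- **`Ž¹(𝒰, M) = B̌¹(𝒰, M)` for `M` supported on a finite set of closed points**, for every family of
opens `𝒰`. [cite: Hartshorne1977, III Thm. 2.7 (case of a zero-dimensional support)] -/
theorem cechMZ1_le_cechMB1_of_finite_support (hS : S.Finite)
    (hT1 : ∀ p ∈ S, IsClosed ({p} : Set X))
    (hsupp : ∀ W : X.Opens, Disjoint (W : Set X) S → ∀ s : MSections f M W, s = 0) :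
    cechMZ1 f M U ≤ cechMB1 f M U := by
  classical
  intro c hc
  have hSc : IsClosed S := MSections.isClosed_of_finite_of_forall_isClosed_singleton hS hT1
  -- the punctured neighbourhoods `N_p = X ∖ (S ∖ {p})`
  have hNc : ∀ p : X, IsClosed (S \ {p}) := fun p =>
    MSections.isClosed_of_finite_of_forall_isClosed_singleton (hS.subset fun _ hx => hx.1)
      (fun q hq => hT1 q hq.1)
  let N : X → X.Opens := fun p => ⟨(S \ {p})ᶜ, (hNc p).isOpen_compl⟩
  have hN : ∀ p, p ∈ N p := fun p h => h.2 rfl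
  have hNS : ∀ {p q x : X}, p ∈ S → q ∈ S → p ≠ q → x ∈ N p → x ∈ N q → x ∉ S := by
    intro p q x _ _ hpq hxp hxq hxS
    have h1 : x = p := by
      by_contra h
      exact hxp ⟨hxS, h⟩
    have h2 : x = q := by
      by_contra h
      exact hxq ⟨hxS, h⟩
    exact hpq (h1.symm.trans h2)
  -- empty index set: nothing to do
  rcases isEmpty_or_nonempty ι with hι | hι
  · exact ⟨fun i => isEmptyElim i, funext fun i => isEmptyElim i⟩
  -- a chosen index `idx p` with `p ∈ U (idx p)` whenever `p` lies in some `U i`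
  let idx : X → ι := fun p =>
    if h : ∃ i, p ∈ U i then h.choose else Classical.arbitrary ι
  have hidx : ∀ {p : X} {i : ι}, p ∈ U i → p ∈ U (idx p) := by
    intro p i hp
    have h : ∃ i, p ∈ U i := ⟨i, hp⟩
    simp only [idx, dif_pos h]
    exact h.choose_spec
  -- the pieces `P i p = U_i ∩ U_{idx p} ∩ N_p` and their union `W i ⊆ U_i`
  let P : ι → X → X.Opens := fun i p => U i ⊓ U (idx p) ⊓ N p
  let W : ι → X.Opens := fun i => ⨆ p : S, P i p
  have hPU : ∀ i p, P i p ≤ U i := fun i p => inf_le_left.trans inf_le_left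
  have hPUU : ∀ i p, P i p ≤ U (idx p) ⊓ U i :=
    fun i p => le_inf (inf_le_left.trans inf_le_right) (inf_le_left.trans inf_le_left)
  have hWU : ∀ i, W i ≤ U i := fun i => iSup_le fun p => hPU i p
  have hSW : ∀ i, S ∩ (U i : Set X) ⊆ W i := by
    intro i p ⟨hpS, hpU⟩
    exact Opens.mem_iSup.mpr ⟨⟨p, hpS⟩, ⟨⟨hpU, hidx hpU⟩, hN p⟩⟩
  -- sections over `S`-disjoint opens vanish: the overlaps of distinct pieces
  have hP0 : ∀ (i : ι) (p q : S), p ≠ q → ∀ (V : X.Opens) (_ : V ≤ P i p ⊓ P i q)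
      (s : MSections f M V), s = 0 := by
    intro i p q hpq V hV s
    refine hsupp V (Set.disjoint_left.mpr fun x hx hxS => ?_) s
    have hx := hV hx
    exact hNS p.2 q.2 (fun e => hpq (Subtype.ext e)) hx.1.2 hx.2.2 hxS
  -- glue the sections `c_{idx p, i}|` over the pieces
  have hβ : ∀ i, ∃ β : MSections f M (W i), ∀ p : S,
      MSections.res f M (le_iSup (fun p : S => P i p) p) β =
        MSections.res f M (hPUU i p) (c (idx p) i) := by
    intro i
    refine MSections.exists_res_eq f M (fun p : S => P i p) (fun p => le_iSup (fun p : S => P i p) p)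
      le_rfl (fun p => MSections.res f M (hPUU i p) (c (idx p) i)) ?_
    intro p q
    by_cases hpq : p = q
    · subst hpq; rfl
    · rw [hP0 i p q hpq _ le_rfl (MSections.res f M _ _), hP0 i p q hpq _ le_rfl (MSections.res f M _ _)]
  choose β hβ using hβ
  -- extend to `U i`
  have hb : ∀ i, ∃ b : MSections f M (U i), MSections.res f M (hWU i) b = β i := fun i =>
    MSections.res_surjective_of_inter_subset f M hsupp hSc (hWU i) (hSW i) (β i)
  choose b hb using hb
  refine ⟨b, ?_⟩
  funext i j
  -- compare `b_j| - b_i|` with `c_{ij}` on `U_i ∩ U_j`: enough near the points of `S`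
  let Q : X → X.Opens := fun p => U i ⊓ U j ⊓ U (idx p) ⊓ N p
  let WQ : X.Opens := ⨆ p : S, Q p
  have hQ : ∀ p, Q p ≤ U i ⊓ U j := fun p => inf_le_left.trans inf_le_left
  have hQi : ∀ p, Q p ≤ P i p := fun p =>
    le_inf (le_inf (inf_le_left.trans (inf_le_left.trans inf_le_left)) (inf_le_left.trans inf_le_right))
      inf_le_right
  have hQj : ∀ p, Q p ≤ P j p := fun p =>
    le_inf (le_inf (inf_le_left.trans (inf_le_left.trans inf_le_right)) (inf_le_left.trans inf_le_right))
      inf_le_right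
  have hWQ : WQ ≤ U i ⊓ U j := iSup_le fun p => hQ p
  have hSWQ : S ∩ ((U i ⊓ U j : X.Opens) : Set X) ⊆ WQ := by
    intro p ⟨hpS, hpU⟩
    exact Opens.mem_iSup.mpr ⟨⟨p, hpS⟩, ⟨⟨hpU, hidx hpU.1⟩, hN p⟩⟩
  apply MSections.res_injective_of_inter_subset f M hsupp hSc hWQ hSWQ
  refine MSections.eq_of_res_eq f M (fun p : S => Q p) (fun p => le_iSup (fun p : S => Q p) p) le_rfl ?_
  intro p
  have hQidx : Q p ≤ U (idx p) := inf_le_left.trans inf_le_right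
  have hQUi : Q p ≤ U i := (hQ p).trans inf_le_left
  have hQUj : Q p ≤ U j := (hQ p).trans inf_le_right
  have hQWi : Q p ≤ W i := (hQi p).trans (le_iSup (fun p : S => P i p) p)
  have hQWj : Q p ≤ W j := (hQj p).trans (le_iSup (fun p : S => P j p) p)
  rw [MSections.res_res, MSections.res_res, cechMD0_apply, map_sub, MSections.res_res,
    MSections.res_res]
  change MSections.res f M hQUj (b j) - MSections.res f M hQUi (b i) =
    MSections.res f M (le_inf hQUi hQUj) (c i j)
  -- `b_j` near `p` is `c_{idx p, j}`, `b_i` near `p` is `c_{idx p, i}`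
  have ej : MSections.res f M hQUj (b j) = MSections.res f M (le_inf hQidx hQUj) (c (idx p) j) := by
    have h1 := congrArg (MSections.res f M hQWj) (hb j)
    rw [MSections.res_res, ← MSections.res_res f M (le_iSup (fun p : S => P j p) p) (hQj p), hβ j p,
      MSections.res_res] at h1
    exact h1
  have ei : MSections.res f M hQUi (b i) = MSections.res f M (le_inf hQidx hQUi) (c (idx p) i) := by
    have h1 := congrArg (MSections.res f M hQWi) (hb i)
    rw [MSections.res_res, ← MSections.res_res f M (le_iSup (fun p : S => P i p) p) (hQi p), hβ i p,
      MSections.res_res] at h1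
    exact h1
  rw [ej, ei]
  -- the cocycle identity `c_{i j} - c_{idx p, j} + c_{idx p, i} = 0` on `Q p`
  have hcoc := cechMZ1.cocycle_res f M U hc (idx p) i j hQidx hQUi hQUj
  symm
  rw [← sub_eq_zero]
  calc MSections.res f M (le_inf hQUi hQUj) (c i j) -
        (MSections.res f M (le_inf hQidx hQUj) (c (idx p) j) -
          MSections.res f M (le_inf hQidx hQUi) (c (idx p) i))
      = MSections.res f M (le_inf hQUi hQUj) (c i j) -
          MSections.res f M (le_inf hQidx hQUj) (c (idx p) j) +
          MSections.res f M (le_inf hQidx hQUi) (c (idx p) i) := by abel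
    _ = 0 := hcoc

/-- **`Ȟ¹(𝒰, M) = 0` for `M` supported on a finite set of closed points**, for every family of opens
`𝒰`. [cite: Hartshorne1977, III Thm. 2.7 (case of a zero-dimensional support)] -/
theorem CechMH1.eq_zero_of_finite_support (hS : S.Finite) (hT1 : ∀ p ∈ S, IsClosed ({p} : Set X))
    (hsupp : ∀ W : X.Opens, Disjoint (W : Set X) S → ∀ s : MSections f M W, s = 0)
    (x : CechMH1 f M U) : x = 0 := by
  obtain ⟨z, rfl⟩ := CechMH1.mk_surjective f M U x
  exact (CechMH1.mk_eq_zero_iff f M U z).mpr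
    (cechMZ1_le_cechMB1_of_finite_support f M U hS hT1 hsupp z.2)

/-- The same as a `Subsingleton`-shaped statement: `Ȟ¹(𝒰, M)` is trivial for `M` supported on a
finite set of closed points. [cite: Hartshorne1977, III Thm. 2.7 (case of a zero-dimensional support)] -/
theorem CechMH1.subsingleton_of_finite_support (hS : S.Finite)
    (hT1 : ∀ p ∈ S, IsClosed ({p} : Set X))
    (hsupp : ∀ W : X.Opens, Disjoint (W : Set X) S → ∀ s : MSections f M W, s = 0) :
    Subsingleton (CechMH1 f M U) :=
  ⟨fun x y => by
    rw [CechMH1.eq_zero_of_finite_support f M U hS hT1 hsupp x,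
      CechMH1.eq_zero_of_finite_support f M U hS hT1 hsupp y]⟩

end FiniteSupport

end Literature.AlgebraicGeometry.Morphisms

end
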